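import Summits.NavierStokesRegularity.NavierStokesRegularity.Theorems.EfficiencyFloorNearSaturationNearMaximiserAmplitude
import HarnessLib

/-!
# Route `EfficiencyFloor`, crux `NearSaturationNearMaximiser` (stmt-NavierStokesRegularity-25482, SHAPE half): the DICHOTOMY
# PENALTY of the Lu–Doering efficiency — splitting the enstrophy into two separated pieces costs the factor `(1 − μ)^{1/4}`

Helper file (`--supports stmt-NavierStokesRegularity-25482`). The open SHAPE half of stmt-25482 is a concentration-compactness
statement for the scale-invariant efficiency `S/(Z^{3/4}·Pal^{3/4})` on `ℝ³`: vanishing of near-maximising sequences is excluded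
by the landed `EfficiencyConcentration` (stmt-23111), dichotomy «by strict superadditivity» (planner text). This file proves the
scalar core of the dichotomy exclusion, as exact inequalities between the numbers `S_i, Z_i, Pal_i` of two pieces:

* `rpow_three_halves_superadditive` — `y^{3/2} + v^{3/2} ≤ (y + v)^{3/2}` for `y, v ≥ 0`;
* `sum_rpow_three_quarters_le` — `Z₁^{3/4}P₁^{3/4} + Z₂^{3/4}P₂^{3/4} ≤ (Z₁+Z₂)^{3/4}(P₁+P₂)^{3/4}` (the envelope is superadditive:
  two admissible pieces with additive `S, Z, Pal` form an admissible whole);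
* `dichotomy_penalty` — if moreover EACH piece carries at most the fraction `1 − μ` of the total enstrophy
  (`Z₁, Z₂ ≤ (1−μ)(Z₁+Z₂)`), then `Z₁^{3/4}P₁^{3/4} + Z₂^{3/4}P₂^{3/4} ≤ (1−μ)^{1/4}·(Z₁+Z₂)^{3/4}(P₁+P₂)^{3/4}`;
* `efficiency_of_split_le` — hence for stretching numbers `S_i ≤ c·Z_i^{3/4}P_i^{3/4}` (`c ≥ 0`):
  `S₁ + S₂ ≤ (1−μ)^{1/4}·c·(Z₁+Z₂)^{3/4}(P₁+P₂)^{3/4}` — a field whose vorticity splits into two far-apart pieces each holding at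
  least the fraction `μ` of the enstrophy (so that `S, Z, Pal` add) has efficiency at most `(1−μ)^{1/4}·c⋆ < c⋆`, whatever the
  palinstrophy split: near-maximising sequences cannot dichotomise in enstrophy.

READING. This is the easy, exact part of the dichotomy step; the analytic part (almost-additivity of `S, Z, Pal` for pieces with
tails, profile decomposition modulo the symmetry group, attainment) remains [XL]. HONEST FRAMING: inequalities between real
numbers; stmt-25482, `LerayFloorGap`, `ProductionEfficiencyDecay` and Navier–Stokes regularity stay OPEN; no summit statement is
proved. [folklore]
-/

-- the problem directory repeats the summit name (`NavierStokesRegularity/NavierStokesRegularity`)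
set_option linter.dupNamespace false

noncomputable section

namespace Summit.NavierStokesRegularity.NavierStokesRegularity.Theorems

namespace NearSaturationNearMaximiser

namespace Dichotomy

/-- **Superadditivity of `t ↦ t^{3/2}` on `[0,∞)`**: `y^{3/2} + v^{3/2} ≤ (y+v)^{3/2}`. [folklore] -/
theorem rpow_three_halves_superadditive {y v : ℝ} (hy : 0 ≤ y) (hv : 0 ≤ v) :
    y ^ (3 / 2 : ℝ) + v ^ (3 / 2 : ℝ) ≤ (y + v) ^ (3 / 2 : ℝ) := by
  have hyv : 0 ≤ y + v := add_nonneg hy hv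
  have hsplit : ∀ {z : ℝ}, 0 ≤ z → z ^ (3 / 2 : ℝ) = z * z ^ (1 / 2 : ℝ) := by
    intro z hz
    rw [show (3 / 2 : ℝ) = 1 + 1 / 2 by norm_num, Real.rpow_add' hz (by norm_num), Real.rpow_one]
  rw [hsplit hy, hsplit hv, hsplit hyv]
  have h1 : y ^ (1 / 2 : ℝ) ≤ (y + v) ^ (1 / 2 : ℝ) :=
    Real.rpow_le_rpow hy (le_add_of_nonneg_right hv) (by norm_num)
  have h2 : v ^ (1 / 2 : ℝ) ≤ (y + v) ^ (1 / 2 : ℝ) :=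
    Real.rpow_le_rpow hv (le_add_of_nonneg_left hy) (by norm_num)
  have h3 : y * y ^ (1 / 2 : ℝ) ≤ y * (y + v) ^ (1 / 2 : ℝ) := mul_le_mul_of_nonneg_left h1 hy
  have h4 : v * v ^ (1 / 2 : ℝ) ≤ v * (y + v) ^ (1 / 2 : ℝ) := mul_le_mul_of_nonneg_left h2 hv
  nlinarith

/-- Two-term Cauchy–Schwarz: `p q + r s ≤ √(p² + r²)·√(q² + s²)`. [folklore] -/
theorem two_term_cauchy_schwarz (p q r s : ℝ) :
    p * q + r * s ≤ Real.sqrt (p ^ 2 + r ^ 2) * Real.sqrt (q ^ 2 + s ^ 2) := by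
  rw [← Real.sqrt_mul (by positivity)]
  refine (le_abs_self _).trans (Real.abs_le_sqrt ?_)
  nlinarith [sq_nonneg (p * s - r * q)]

/-- `(x^{3/4})² = x^{3/2}` for `x ≥ 0`. [folklore] -/
theorem rpow_three_quarters_sq {x : ℝ} (hx : 0 ≤ x) : (x ^ (3 / 4 : ℝ)) ^ 2 = x ^ (3 / 2 : ℝ) := by
  rw [← Real.rpow_mul_natCast hx]
  norm_num

/-- `√(x^{3/2}) = x^{3/4}` for `x ≥ 0`. [folklore] -/
theorem sqrt_rpow_three_halves {x : ℝ} (hx : 0 ≤ x) : Real.sqrt (x ^ (3 / 2 : ℝ)) = x ^ (3 / 4 : ℝ) := by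
  rw [← rpow_three_quarters_sq hx, Real.sqrt_sq (Real.rpow_nonneg hx _)]

/-- **The Lu–Doering envelope is superadditive over two pieces**:
`Z₁^{3/4}P₁^{3/4} + Z₂^{3/4}P₂^{3/4} ≤ (Z₁+Z₂)^{3/4}(P₁+P₂)^{3/4}` (`Z_i, P_i ≥ 0`). [folklore] -/
theorem sum_rpow_three_quarters_le {Z₁ Z₂ P₁ P₂ : ℝ} (hZ₁ : 0 ≤ Z₁) (hZ₂ : 0 ≤ Z₂) (hP₁ : 0 ≤ P₁) (hP₂ : 0 ≤ P₂) :
    Z₁ ^ (3 / 4 : ℝ) * P₁ ^ (3 / 4 : ℝ) + Z₂ ^ (3 / 4 : ℝ) * P₂ ^ (3 / 4 : ℝ) ≤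
      (Z₁ + Z₂) ^ (3 / 4 : ℝ) * (P₁ + P₂) ^ (3 / 4 : ℝ) := by
  have hcs := two_term_cauchy_schwarz (Z₁ ^ (3 / 4 : ℝ)) (P₁ ^ (3 / 4 : ℝ)) (Z₂ ^ (3 / 4 : ℝ)) (P₂ ^ (3 / 4 : ℝ))
  rw [rpow_three_quarters_sq hZ₁, rpow_three_quarters_sq hZ₂, rpow_three_quarters_sq hP₁,
    rpow_three_quarters_sq hP₂] at hcs
  have hZ : Real.sqrt (Z₁ ^ (3 / 2 : ℝ) + Z₂ ^ (3 / 2 : ℝ)) ≤ (Z₁ + Z₂) ^ (3 / 4 : ℝ) := by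
    rw [← sqrt_rpow_three_halves (add_nonneg hZ₁ hZ₂)]
    exact Real.sqrt_le_sqrt (rpow_three_halves_superadditive hZ₁ hZ₂)
  have hP : Real.sqrt (P₁ ^ (3 / 2 : ℝ) + P₂ ^ (3 / 2 : ℝ)) ≤ (P₁ + P₂) ^ (3 / 4 : ℝ) := by
    rw [← sqrt_rpow_three_halves (add_nonneg hP₁ hP₂)]
    exact Real.sqrt_le_sqrt (rpow_three_halves_superadditive hP₁ hP₂)
  exact hcs.trans (mul_le_mul hZ hP (Real.sqrt_nonneg _) (Real.rpow_nonneg (add_nonneg hZ₁ hZ₂) _))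

/-- **Dichotomy penalty.** If each of the two pieces carries at most the fraction `1 − μ` of the total enstrophy
(`Z₁ ≤ (1−μ)(Z₁+Z₂)`, `Z₂ ≤ (1−μ)(Z₁+Z₂)`; when both pieces are nonzero this forces `μ ≤ 1/2`), then
`Z₁^{3/4}P₁^{3/4} + Z₂^{3/4}P₂^{3/4} ≤ (1−μ)^{1/4}·(Z₁+Z₂)^{3/4}(P₁+P₂)^{3/4}`. [folklore] -/
theorem dichotomy_penalty {Z₁ Z₂ P₁ P₂ μ : ℝ} (hZ₁ : 0 ≤ Z₁) (hZ₂ : 0 ≤ Z₂) (hP₁ : 0 ≤ P₁) (hP₂ : 0 ≤ P₂)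
    (h₁ : Z₁ ≤ (1 - μ) * (Z₁ + Z₂)) (h₂ : Z₂ ≤ (1 - μ) * (Z₁ + Z₂)) :
    Z₁ ^ (3 / 4 : ℝ) * P₁ ^ (3 / 4 : ℝ) + Z₂ ^ (3 / 4 : ℝ) * P₂ ^ (3 / 4 : ℝ) ≤
      (1 - μ) ^ (1 / 4 : ℝ) * ((Z₁ + Z₂) ^ (3 / 4 : ℝ) * (P₁ + P₂) ^ (3 / 4 : ℝ)) := by
  set Z : ℝ := Z₁ + Z₂ with hZdef
  have hZ0 : 0 ≤ Z := add_nonneg hZ₁ hZ₂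
  -- degenerate total enstrophy: everything vanishes
  rcases hZ0.eq_or_lt with hZzero | hZpos
  · have hZ₁0 : Z₁ = 0 := le_antisymm (by linarith [hZzero.symm.le]) hZ₁
    have hZ₂0 : Z₂ = 0 := le_antisymm (by linarith [hZzero.symm.le]) hZ₂
    rw [hZ₁0, hZ₂0, ← hZzero, Real.zero_rpow (by norm_num)]
    simp
  have h1μ : 0 ≤ 1 - μ := by nlinarith
  -- `Z_i^{3/2} = Z_i^{1/2}·Z_i ≤ ((1−μ)Z)^{1/2}·Z_i`, summed: `Z₁^{3/2} + Z₂^{3/2} ≤ (1−μ)^{1/2} Z^{3/2}`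
  have hsplit : ∀ {z : ℝ}, 0 ≤ z → z ^ (3 / 2 : ℝ) = z ^ (1 / 2 : ℝ) * z := by
    intro z hz
    rw [show (3 / 2 : ℝ) = 1 / 2 + 1 by norm_num, Real.rpow_add' hz (by norm_num), Real.rpow_one]
  have hhalf : ∀ {z : ℝ}, 0 ≤ z → z ≤ (1 - μ) * Z → z ^ (1 / 2 : ℝ) ≤ ((1 - μ) * Z) ^ (1 / 2 : ℝ) :=
    fun hz hle => Real.rpow_le_rpow hz hle (by norm_num)
  have hZ32 : Z₁ ^ (3 / 2 : ℝ) + Z₂ ^ (3 / 2 : ℝ) ≤ ((1 - μ) * Z) ^ (1 / 2 : ℝ) * Z := by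
    rw [hsplit hZ₁, hsplit hZ₂]
    have e1 := mul_le_mul_of_nonneg_right (hhalf hZ₁ h₁) hZ₁
    have e2 := mul_le_mul_of_nonneg_right (hhalf hZ₂ h₂) hZ₂
    calc Z₁ ^ (1 / 2 : ℝ) * Z₁ + Z₂ ^ (1 / 2 : ℝ) * Z₂
        ≤ ((1 - μ) * Z) ^ (1 / 2 : ℝ) * Z₁ + ((1 - μ) * Z) ^ (1 / 2 : ℝ) * Z₂ := add_le_add e1 e2
      _ = ((1 - μ) * Z) ^ (1 / 2 : ℝ) * Z := by rw [hZdef]; ring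
  -- rewrite the bound as `((1−μ)^{1/4} Z^{3/4})²`
  have hkey : ((1 - μ) * Z) ^ (1 / 2 : ℝ) * Z = ((1 - μ) ^ (1 / 4 : ℝ) * Z ^ (3 / 4 : ℝ)) ^ 2 := by
    rw [Real.mul_rpow h1μ hZ0, mul_pow, ← Real.rpow_mul_natCast h1μ, ← Real.rpow_mul_natCast hZ0]
    norm_num
    rw [mul_assoc, ← Real.rpow_add_one hZpos.ne']
    norm_num
  have hcs := two_term_cauchy_schwarz (Z₁ ^ (3 / 4 : ℝ)) (P₁ ^ (3 / 4 : ℝ)) (Z₂ ^ (3 / 4 : ℝ)) (P₂ ^ (3 / 4 : ℝ))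
  rw [rpow_three_quarters_sq hZ₁, rpow_three_quarters_sq hZ₂, rpow_three_quarters_sq hP₁,
    rpow_three_quarters_sq hP₂] at hcs
  have hZb : Real.sqrt (Z₁ ^ (3 / 2 : ℝ) + Z₂ ^ (3 / 2 : ℝ)) ≤ (1 - μ) ^ (1 / 4 : ℝ) * Z ^ (3 / 4 : ℝ) := by
    have hnn : 0 ≤ (1 - μ) ^ (1 / 4 : ℝ) * Z ^ (3 / 4 : ℝ) := by positivity
    rw [← Real.sqrt_sq hnn, ← hkey]
    exact Real.sqrt_le_sqrt hZ32
  have hPb : Real.sqrt (P₁ ^ (3 / 2 : ℝ) + P₂ ^ (3 / 2 : ℝ)) ≤ (P₁ + P₂) ^ (3 / 4 : ℝ) := by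
    rw [← sqrt_rpow_three_halves (add_nonneg hP₁ hP₂)]
    exact Real.sqrt_le_sqrt (rpow_three_halves_superadditive hP₁ hP₂)
  calc Z₁ ^ (3 / 4 : ℝ) * P₁ ^ (3 / 4 : ℝ) + Z₂ ^ (3 / 4 : ℝ) * P₂ ^ (3 / 4 : ℝ)
      ≤ Real.sqrt (Z₁ ^ (3 / 2 : ℝ) + Z₂ ^ (3 / 2 : ℝ)) * Real.sqrt (P₁ ^ (3 / 2 : ℝ) + P₂ ^ (3 / 2 : ℝ)) := hcs
    _ ≤ ((1 - μ) ^ (1 / 4 : ℝ) * Z ^ (3 / 4 : ℝ)) * (P₁ + P₂) ^ (3 / 4 : ℝ) :=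
        mul_le_mul hZb hPb (Real.sqrt_nonneg _) (by positivity)
    _ = (1 - μ) ^ (1 / 4 : ℝ) * (Z ^ (3 / 4 : ℝ) * (P₁ + P₂) ^ (3 / 4 : ℝ)) := by ring

/-- **Efficiency of a split field.** With stretching numbers dominated piecewise by the envelope, `S_i ≤ c·Z_i^{3/4}P_i^{3/4}`
(`c ≥ 0`), and each piece holding at most the fraction `1 − μ` of the enstrophy:
`S₁ + S₂ ≤ (1−μ)^{1/4}·c·(Z₁+Z₂)^{3/4}(P₁+P₂)^{3/4}` — the efficiency of the whole is at most `(1−μ)^{1/4}·c`. [folklore] -/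
theorem efficiency_of_split_le {c S₁ S₂ Z₁ Z₂ P₁ P₂ μ : ℝ} (hc : 0 ≤ c) (hZ₁ : 0 ≤ Z₁) (hZ₂ : 0 ≤ Z₂) (hP₁ : 0 ≤ P₁)
    (hP₂ : 0 ≤ P₂) (h₁ : Z₁ ≤ (1 - μ) * (Z₁ + Z₂)) (h₂ : Z₂ ≤ (1 - μ) * (Z₁ + Z₂))
    (hS₁ : S₁ ≤ c * Z₁ ^ (3 / 4 : ℝ) * P₁ ^ (3 / 4 : ℝ)) (hS₂ : S₂ ≤ c * Z₂ ^ (3 / 4 : ℝ) * P₂ ^ (3 / 4 : ℝ)) :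
    S₁ + S₂ ≤ (1 - μ) ^ (1 / 4 : ℝ) * c * ((Z₁ + Z₂) ^ (3 / 4 : ℝ) * (P₁ + P₂) ^ (3 / 4 : ℝ)) := by
  have hpen := dichotomy_penalty hZ₁ hZ₂ hP₁ hP₂ h₁ h₂
  have h := mul_le_mul_of_nonneg_left hpen hc
  calc S₁ + S₂ ≤ c * (Z₁ ^ (3 / 4 : ℝ) * P₁ ^ (3 / 4 : ℝ) + Z₂ ^ (3 / 4 : ℝ) * P₂ ^ (3 / 4 : ℝ)) := by linarith
    _ ≤ c * ((1 - μ) ^ (1 / 4 : ℝ) * ((Z₁ + Z₂) ^ (3 / 4 : ℝ) * (P₁ + P₂) ^ (3 / 4 : ℝ))) := h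
    _ = (1 - μ) ^ (1 / 4 : ℝ) * c * ((Z₁ + Z₂) ^ (3 / 4 : ℝ) * (P₁ + P₂) ^ (3 / 4 : ℝ)) := by ring

end Dichotomy

end NearSaturationNearMaximiser

end Summit.NavierStokesRegularity.NavierStokesRegularity.Theorems

end
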